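import Literature.NumberTheory.Transcendental.TorusConeCount
import Literature.NumberTheory.Transcendental.TorusSaturation
import HarnessLib

/-!
# Proof of Philippon's zero estimate on `𝔾ₘ^d` (multiplicity-free case)

Topic: `Literature/NumberTheory/Transcendental`. This file discharges the named fact
`Philippon1986_zeroEstimate_torus` (`TorusZeroEstimate.lean`; Philippon, Bull. SMF 114 (1986)
Thm. 2.1 for `G = 𝔾ₘ^d`, `T = 0`; Nesterenko–Philippon (eds.), LNM 1752, Ch. 11 (D. Roy) Thm. 4.1
with `W = 0`), following the printed proof of Thm. 4.1 (pp. 218–220) in the algebraic language of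
vanishing ideals:

1. `X_k = {z ∈ T | P(σz) = 0 for all σ ∈ Σ(k)}`, `k = 0, …, d` (`Σ(k)` = `Torus.prodSet S k`),
   decrease, `e ∈ X_d`, and `dim I(X_0) ≤ d - 1` (`P ∈ I(X_0)`); by the pigeonhole principle some
   `ρ < d` has `dim I(X_ρ) = dim I(X_{ρ+1})`.
2. A minimal prime `𝔭₀` of `I(X_{ρ+1})` of maximal dimension is relevant to the torus
   (`TorusScaling.lean`); `V₀ = Z(𝔭₀) ∩ T ⊆ X_{ρ+1}` and `I(V₀) = 𝔭₀`.
3. `E = {g | gV₀ ⊆ X_ρ} = {g | I(X_ρ) ⊆ ρ_g⁻¹ 𝔭₀} ⊇ Σ`; the `ρ_g⁻¹ 𝔭₀`, `g ∈ E`, are minimal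
   primes of `I(X_ρ)` (same dimension), so `E` is a finite union of cosets of the stabiliser
   `H = {g | ρ_g⁻¹ 𝔭₀ = 𝔭₀}`, which is a subtorus `H_B` (`TorusStabilizer.lean`); with `A` the
   saturation of `B` (`TorusSaturation.lean`) `E` is stable under `H_A` and meets finitely many of
   its cosets.
4. `E` is the set of torus zeros of the polynomials `ρ_{σv} P` (`σ ∈ Σ(ρ)`, `v ∈ V₀`) of degree
   `≤ D`, so `Card((Σ·H_A)/H_A) ≤ Card((E·H_A)/H_A) ≤ D^{rank A}` (`TorusConeCount.lean`, the
   Bézout-type count of LNM 1752 Ch. 11 Prop. 2.2 on the cone); and `ρ_v P` (`v ∈ V₀`) is a non-zero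
   polynomial of degree `≤ D` vanishing on `H_A ⊆ E`, whence the short vector of `A`
   (`Torus.exists_short_mem_of_vanishes`, the "Moreover" clause).

## References

* P. Philippon, *Lemmes de zéros dans les groupes algébriques commutatifs*, Bull. Soc. Math.
  France 114 (1986), 355–383, Thm. 2.1. [Philippon1986]
* Yu. V. Nesterenko, P. Philippon (eds.), *Introduction to Algebraic Independence Theory*,
  LNM 1752 (2001), Ch. 11 (D. Roy), Thm. 4.1 and its proof (pp. 218–220). [NesterenkoPhilippon2001]
-/

noncomputable section

open MvPolynomial

namespace Literature.NumberTheory.Transcendental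


open Torus

variable {d : ℕ}

-- the scaling `ρ_g : X_i ↦ g_i X_i` (as in `TorusScaling.lean`; written without the dimension so
-- that it can be used inside the proof of the fact, where `d` is a bound variable)
local notation "ρ[" g "]" =>
  (MvPolynomial.aeval (R := ℂ) (S₁ := MvPolynomial (Fin _) ℂ)
    (fun i : Fin _ => MvPolynomial.C (((g : Fin _ → ℂˣ) i : ℂˣ) : ℂ) * MvPolynomial.X i))

/-! ## Product sets -/

/-- `e ∈ Σ(k)` when `e ∈ Σ`. [folklore] -/
theorem one_mem_prodSet {S : Set (Torus d)} (h1 : (1 : Torus d) ∈ S) (k : ℕ) :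
    (1 : Torus d) ∈ prodSet S k :=
  ⟨fun _ => 1, fun _ => h1, by simp⟩

/-- `Σ · Σ(k) ⊆ Σ(k+1)`. [folklore] -/
theorem mul_mem_prodSet_succ {S : Set (Torus d)} {s σ : Torus d} (hs : s ∈ S) {k : ℕ}
    (hσ : σ ∈ prodSet S k) : s * σ ∈ prodSet S (k + 1) := by
  obtain ⟨τ, hτ, rfl⟩ := hσ
  refine ⟨Fin.cons s τ, ?_, ?_⟩
  · refine Fin.cases ?_ (fun i => ?_) <;> simp [hs, hτ]
  · simp [Fin.prod_univ_succ]

/-- `Σ(k) ⊆ Σ(k+1)` when `e ∈ Σ`. [folklore] -/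
theorem prodSet_subset_succ {S : Set (Torus d)} (h1 : (1 : Torus d) ∈ S) (k : ℕ) :
    prodSet S k ⊆ prodSet S (k + 1) := fun σ hσ => by
  simpa using mul_mem_prodSet_succ h1 hσ

/-! ## Torus points -/

/-- Coordinates determine the torus element. [folklore] -/
theorem torus_coe_injective : Function.Injective (fun (g : Torus d) (i : Fin d) => ((g i : ℂˣ) : ℂ)) :=
  fun _ _ h => funext fun i => Units.val_injective (congr_fun h i)

/-- `(ρ_g f)(v) = f(g v)` on torus points (a smul-free form of `aeval_scale`). [folklore] -/
theorem aeval_coe_scale (g v : Torus d) (f : MvPolynomial (Fin d) ℂ) :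
    MvPolynomial.aeval (fun i => ((v i : ℂˣ) : ℂ)) (ρ[g] f) =
      MvPolynomial.aeval (fun i => (((g * v) i : ℂˣ) : ℂ)) f := by
  rw [← AlgHom.comp_apply, MvPolynomial.comp_aeval]
  have : (fun i => MvPolynomial.aeval (fun i => ((v i : ℂˣ) : ℂ))
      (MvPolynomial.C (((g i : ℂˣ)) : ℂ) * MvPolynomial.X i)) = fun i => (((g * v) i : ℂˣ) : ℂ) := by
    funext i
    simp
  rw [this]

/-- `(ρ_σ P)(z) = P(σ z)`. [folklore] -/
theorem aevalAt_scale (σ z : Torus d) (P : MvPolynomial (Fin d) ℂ) :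
    aevalAt (ρ[σ] P) z = aevalAt P (σ * z) := by
  rw [aevalAt_eq_aeval, aevalAt_eq_aeval, aeval_coe_scale]

/-! ## The zero estimate -/

/-- **Philippon's zero estimate on `𝔾ₘ^d`, multiplicity-free case, proved**
(`Philippon1986_zeroEstimate_torus`; Philippon 1986 Thm. 2.1 for `G = 𝔾ₘ^d`, `T = 0`;
Nesterenko–Philippon (eds.) LNM 1752, Ch. 11 Thm. 4.1 with `W = 0`). See the module docstring for
the architecture of the proof. [cite: NesterenkoPhilippon2001, Ch. 11 Thm 4.1 p. 218 (proof pp. 218–220)] -/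
theorem Philippon1986_zeroEstimate_torus_holds : Philippon1986_zeroEstimate_torus := by
  intro d hd S P D hSfin h1S hP0 hPD hv
  classical
  -- Step 0: `D ≥ 1`
  have hD : 1 ≤ D := by
    by_contra hD0
    push Not at hD0
    have hdeg0 : P.totalDegree = 0 := by omega
    rw [totalDegree_eq_zero_iff_eq_C] at hdeg0
    have h1 : aevalAt P 1 = 0 := hv 1 ⟨fun _ => 1, fun _ => h1S, by simp⟩
    rw [hdeg0, aevalAt_eq_aeval, aeval_C, Algebra.algebraMap_self_apply] at h1
    exact hP0 (by rw [hdeg0, h1, map_zero])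
  -- Step 1: the sets `X k` (`= X_{k+1}` of LNM 1752) and their vanishing ideals
  set X : ℕ → Set (Torus d) := fun k => {z | ∀ σ ∈ prodSet S k, aevalAt P (σ * z) = 0} with hXdef
  have hmemX : ∀ k z, z ∈ X k ↔ ∀ σ ∈ prodSet S k, aevalAt P (σ * z) = 0 := fun k z => Iff.rfl
  set I : ℕ → Ideal (MvPolynomial (Fin d) ℂ) := fun k =>
    vanishingIdeal ℂ ((fun (g : Torus d) (i : Fin d) => ((g i : ℂˣ) : ℂ)) '' X k) with hIdef
  have hIdef' : ∀ k, I k = vanishingIdeal ℂ ((fun (g : Torus d) (i : Fin d) => ((g i : ℂˣ) : ℂ)) '' X k) := fun k => rfl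
  have hXanti : ∀ k, X (k + 1) ⊆ X k := fun k z hz σ hσ => hz σ (prodSet_subset_succ h1S k hσ)
  have hImono : ∀ k, I k ≤ I (k + 1) := fun k =>
    vanishingIdeal_anti_mono (Set.image_mono (hXanti k))
  have hImono' : ∀ k k', k ≤ k' → I k ≤ I k' := by
    intro k k' hkk'
    induction hkk' with
    | refl => exact le_rfl
    | step _ ih => exact ih.trans (hImono _)
  have h1X : ∀ k, k ≤ d → (1 : Torus d) ∈ X k := by
    intro k hk σ hσ
    rw [mul_one]
    obtain ⟨τ, hτ, rfl⟩ := hσ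
    -- pad `τ` with ones to length `d`
    have : (∏ i, τ i) ∈ prodSet S d := by
      have hpad : ∀ j, (∏ i, τ i) ∈ prodSet S (k + j) := by
        intro j
        induction j with
        | zero => exact ⟨τ, hτ, rfl⟩
        | succ j ih =>
          have h := mul_mem_prodSet_succ h1S ih
          rw [one_mul] at h
          exact h
      have := hpad (d - k)
      rwa [Nat.add_sub_cancel' hk] at this
    exact hv _ this
  have hIne : ∀ k, k ≤ d → I k ≠ ⊤ := by
    intro k hk htop
    have h1 : (1 : MvPolynomial (Fin d) ℂ) ∈ I k := by rw [htop]; exact Submodule.mem_top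
    rw [hIdef', mem_vanishingIdeal_iff] at h1
    have := h1 _ ⟨1, h1X k hk, rfl⟩
    rw [map_one] at this
    exact one_ne_zero this
  -- `ρ_σ P ∈ I k` for `σ ∈ Σ(k)`
  have hscaleI : ∀ k, ∀ σ ∈ prodSet S k, ρ[σ] P ∈ I k := by
    intro k σ hσ
    rw [hIdef', mem_vanishingIdeal_iff]
    rintro _ ⟨z, hz, rfl⟩
    rw [← aevalAt_eq_aeval, aevalAt_scale]
    exact hz σ hσ
  -- conversely a torus point killed by `I k` lies in `X k`
  have hXofI : ∀ k (z : Torus d), (∀ f ∈ I k, aevalAt f z = 0) → z ∈ X k := by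
    intro k z hz σ hσ
    rw [← aevalAt_scale]
    exact hz _ (hscaleI k σ hσ)
  have hPI0 : P ∈ I 0 := by
    have := hscaleI 0 1 (one_mem_prodSet h1S 0)
    rwa [scale_one] at this
  -- dimensions
  have hdims : ∀ k, ∃ nk : ℕ, k ≤ d → ringKrullDim (MvPolynomial (Fin d) ℂ ⧸ I k) = nk ∧ nk ≤ d := by
    intro k
    by_cases hk : k ≤ d
    · obtain ⟨nk, hnk, hnkd⟩ :=
        Literature.RingTheory.MvPolynomial.exists_nat_ringKrullDim_quotient_eq (K := ℂ) (hIne k hk)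
      exact ⟨nk, fun _ => ⟨hnk, hnkd⟩⟩
    · exact ⟨0, fun h => absurd h hk⟩
  choose n hn using hdims
  have hn0 : n 0 + 1 ≤ d := by
    have h := Literature.RingTheory.KrullDimension.ringKrullDim_quotient_add_one_le
      (A := MvPolynomial (Fin d) ℂ) (𝔭 := I 0) (fun h0 => hP0 (by
        have := hPI0; rw [h0] at this; exact (Submodule.mem_bot _).mp this))
    rw [(hn 0 (Nat.zero_le d)).1, Literature.RingTheory.MvPolynomial.ringKrullDim_mvPolynomial_fin] at h
    exact_mod_cast h
  have hnanti : ∀ k, k + 1 ≤ d → n (k + 1) ≤ n k := by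
    intro k hk
    have h := ringKrullDim_le_of_surjective (Ideal.Quotient.factor (hImono k))
      (Ideal.Quotient.factor_surjective _)
    rw [(hn k (by omega)).1, (hn (k + 1) hk).1] at h
    exact_mod_cast h
  -- pigeonhole
  obtain ⟨r, hrd, hr⟩ : ∃ r, r + 1 ≤ d ∧ n r = n (r + 1) := by
    by_contra hcon
    push Not at hcon
    have hstrict : ∀ k, k + 1 ≤ d → n (k + 1) + 1 ≤ n k := fun k hk =>
      Nat.lt_of_le_of_ne (hnanti k hk) (Ne.symm (hcon k hk))
    have hchain : ∀ k, k ≤ d → n k + k ≤ n 0 := by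
      intro k hk
      induction k with
      | zero => simp
      | succ k ih => have := hstrict k hk; have := ih (by omega); omega
    have := hchain d le_rfl
    omega
  -- Step 2: a relevant minimal prime `𝔭₀` of `I (r+1)` of maximal dimension, and `V₀`
  obtain ⟨𝔭₀, h𝔭₀min, h𝔭₀dim⟩ :=
    Literature.RingTheory.MvPolynomial.exists_minimalPrimes_ringKrullDim_quotient_eq (hn (r + 1) hrd).1
  haveI h𝔭₀prime : 𝔭₀.IsPrime := h𝔭₀min.1.1
  have hrel : ∀ i, (MvPolynomial.X i : MvPolynomial (Fin d) ℂ) ∉ 𝔭₀ :=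
    forall_X_notMem_of_mem_minimalPrimes_vanishingIdeal (by
      rintro _ ⟨z, -, rfl⟩ i; exact Units.ne_zero _) h𝔭₀min
  set V₀ : Set (Fin d → ℂ) := zeroLocus ℂ 𝔭₀ ∩ {x | ∀ i, x i ≠ 0} with hV₀
  have hIV₀ : vanishingIdeal ℂ V₀ = 𝔭₀ := vanishingIdeal_zeroLocus_inter_torus hrel
  obtain ⟨v₀, hv₀⟩ := zeroLocus_inter_torus_nonempty hrel
  -- `V₀ ⊆ X (r+1)` (after lifting to the torus)
  have hV₀X : ∀ v' : Torus d, (fun i => ((v' i : ℂˣ) : ℂ)) ∈ V₀ → v' ∈ X (r + 1) := by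
    intro v' hv'
    apply hXofI
    intro f hf
    rw [aevalAt_eq_aeval]
    exact (mem_zeroLocus_iff.mp hv'.1) f (h𝔭₀min.1.2 hf)
  -- Step 3: the set `E`
  set E : Set (Torus d) := {g | ∀ v' : Torus d, (fun i => ((v' i : ℂˣ) : ℂ)) ∈ V₀ →
    ∀ σ ∈ prodSet S r, aevalAt P (σ * g * v') = 0} with hEdef
  have hmemE : ∀ g, g ∈ E ↔ ∀ v' : Torus d, (fun i => ((v' i : ℂˣ) : ℂ)) ∈ V₀ →
      ∀ σ ∈ prodSet S r, aevalAt P (σ * g * v') = 0 := fun g => Iff.rfl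
  have hSE : S ⊆ E := by
    intro s hs v' hv' σ hσ
    have := hV₀X v' hv' _ (mul_mem_prodSet_succ hs hσ)
    rwa [show s * σ * v' = σ * s * v' by rw [mul_comm s σ]] at this
  have h1E : (1 : Torus d) ∈ E := by
    intro v' hv' σ hσ
    rw [mul_one]
    exact hXanti r (hV₀X v' hv') σ hσ
  -- `E` through ideals: `g ∈ E ↔ I r ≤ ρ_g⁻¹ 𝔭₀`
  have hEI : ∀ g, g ∈ E ↔ I r ≤ 𝔭₀.comap ρ[g] := by
    intro g
    constructor
    · intro hg f hf
      rw [Ideal.mem_comap, ← hIV₀, mem_vanishingIdeal_iff]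
      rintro v ⟨hv𝔭, hvU⟩
      obtain ⟨v', rfl⟩ := exists_torus_eq hvU
      rw [aeval_coe_scale, ← aevalAt_eq_aeval]
      have hgv : g * v' ∈ X r := by
        intro σ hσ
        rw [← mul_assoc]
        exact hg v' ⟨hv𝔭, hvU⟩ σ hσ
      exact (mem_vanishingIdeal_iff.mp hf) _ ⟨_, hgv, rfl⟩
    · intro hle v' hv' σ hσ
      have h1 : ρ[g] (ρ[σ] P) ∈ 𝔭₀ := Ideal.mem_comap.mp (hle (hscaleI r σ hσ))
      rw [scale_scale, ← hIV₀, mem_vanishingIdeal_iff] at h1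
      have := h1 _ hv'
      rw [← aevalAt_eq_aeval, aevalAt_scale] at this
      rwa [show σ * g * v' = g * σ * v' by rw [mul_comm σ g]]
  -- the stabiliser of `𝔭₀` and its saturation
  obtain ⟨B, hB⟩ := exists_stabilizer_eq_subtorus hrel
  obtain ⟨A, hBA, hsat, hfinBA⟩ := exists_saturation B
  have hAB : subtorus A ≤ subtorus B := fun z hz b hb => hz b (hBA hb)
  -- `E` is stable under the stabiliser
  have hstabB : ∀ g ∈ E, ∀ h ∈ subtorus B, g * h ∈ E := by
    intro g hg h hh
    rw [hEI] at hg ⊢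
    intro f hf
    have h1 : ρ[g] f ∈ 𝔭₀ := Ideal.mem_comap.mp (hg hf)
    have h2 : ρ[h] (ρ[g] f) ∈ 𝔭₀ := by
      have := (hB h).mpr hh
      rw [← this] at h1
      exact Ideal.mem_comap.mp h1
    rw [Ideal.mem_comap, mul_comm g h, ← scale_scale]
    exact h2
  have hstab : ∀ g ∈ E, ∀ h ∈ subtorus A, g * h ∈ E := fun g hg h hh => hstabB g hg h (hAB hh)
  -- Step 3': finitely many cosets — the `ρ_g⁻¹ 𝔭₀`, `g ∈ E`, are minimal primes of `I r`
  set π : Torus d → Torus d ⧸ subtorus A := QuotientGroup.mk with hπ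
  have hmin : ∀ g ∈ E, 𝔭₀.comap ρ[g] ∈ (I r).minimalPrimes := by
    intro g hg
    haveI : (𝔭₀.comap ρ[g]).IsPrime := Ideal.comap_isPrime _ _
    refine mem_minimalPrimes_of_ringKrullDim_eq ((hEI g).mp hg) (hn r (by omega)).1 ?_
    rw [ringKrullDim_quotient_comap_scale, h𝔭₀dim, hr]
  have hfiber : ∀ g ∈ E, ∀ g' ∈ E, 𝔭₀.comap ρ[g] = 𝔭₀.comap ρ[g'] → g⁻¹ * g' ∈ subtorus B := by
    intro g hg g' hg' heq
    rw [← hB]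
    have key : ∀ f, f ∈ 𝔭₀.comap ρ[g⁻¹ * g'] ↔ ρ[g⁻¹] f ∈ 𝔭₀.comap ρ[g'] := by
      intro f
      rw [Ideal.mem_comap, Ideal.mem_comap, scale_scale, mul_comm g' g⁻¹]
    ext f
    rw [key, ← heq, Ideal.mem_comap, scale_scale, mul_inv_cancel, scale_one]
  have hfin : (π '' E).Finite := by
    have hcover : π '' E ⊆ ⋃ 𝔮 ∈ (I r).minimalPrimes,
        π '' {g' | g' ∈ E ∧ 𝔭₀.comap ρ[g'] = 𝔮} := by
      rintro _ ⟨g, hg, rfl⟩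
      rw [Set.mem_iUnion₂]
      exact ⟨_, hmin g hg, ⟨g, ⟨hg, rfl⟩, rfl⟩⟩
    refine Set.Finite.subset (Set.Finite.biUnion
      (Ideal.finite_minimalPrimes_of_isNoetherianRing _ (I r)) fun 𝔮 _ => ?_) hcover
    -- each fibre is contained in a translate of the finite image of `H_B`
    by_cases hne : ∃ g₀ ∈ E, 𝔭₀.comap ρ[g₀] = 𝔮
    · obtain ⟨g₀, hg₀, hg₀𝔮⟩ := hne
      refine (hfinBA.image fun c => π g₀ * c).subset ?_
      rintro _ ⟨g', ⟨hg', hg'𝔮⟩, rfl⟩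
      refine ⟨π (g₀⁻¹ * g'), ⟨g₀⁻¹ * g', hfiber g₀ hg₀ g' hg' (hg₀𝔮.trans hg'𝔮.symm), rfl⟩, ?_⟩
      change (QuotientGroup.mk g₀ : Torus d ⧸ subtorus A) * QuotientGroup.mk (g₀⁻¹ * g') =
        QuotientGroup.mk g'
      rw [← QuotientGroup.mk_mul, mul_inv_cancel_left]
    · convert Set.finite_empty
      ext c
      simp only [Set.mem_image, Set.mem_setOf_eq, Set.mem_empty_iff_false, iff_false]
      rintro ⟨g', ⟨hg', hg'𝔮⟩, -⟩
      exact hne ⟨g', hg', hg'𝔮⟩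
  -- Step 4: the Bézout-type count on the cone
  obtain ⟨v₀', hv₀'⟩ := exists_torus_eq hv₀.2
  set 𝓕 : Set (MvPolynomial (Fin d) ℂ) :=
    (fun p : Torus d × Torus d => ρ[p.1 * p.2] P) ''
      (prodSet S r ×ˢ {v' | (fun i => ((v' i : ℂˣ) : ℂ)) ∈ V₀}) with h𝓕def
  have hdeg : ∀ q ∈ 𝓕, q.totalDegree ≤ D := by
    rintro _ ⟨p, -, rfl⟩
    exact (totalDegree_scale_le _ P).trans hPD
  have hE𝓕 : ∀ g : Torus d, g ∈ E ↔ ∀ q ∈ 𝓕, aevalAt q g = 0 := by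
    intro g
    rw [hmemE]
    constructor
    · rintro hg _ ⟨⟨σ, v'⟩, ⟨hσ, hv'⟩, rfl⟩
      rw [aevalAt_scale, show σ * v' * g = σ * g * v' by rw [mul_assoc, mul_comm v' g, ← mul_assoc]]
      exact hg v' hv' σ hσ
    · intro hg v' hv' σ hσ
      have := hg _ ⟨⟨σ, v'⟩, ⟨hσ, hv'⟩, rfl⟩
      rwa [aevalAt_scale, show σ * v' * g = σ * g * v' by
        rw [mul_assoc, mul_comm v' g, ← mul_assoc]] at this
  have hcount := ncard_image_mk_le_pow (A := A) hD hdeg hE𝓕 hstab hfin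
  -- Step 5: the short vector
  set q : MvPolynomial (Fin d) ℂ := ρ[v₀'] P with hqdef
  have hq0 : q ≠ 0 := fun h => hP0 ((scale_bijective v₀').1 (by rw [map_zero]; exact h))
  have hqdeg : q.totalDegree ≤ D := (totalDegree_scale_le _ P).trans hPD
  have hqv : ∀ z ∈ subtorus A, aevalAt q z = 0 := by
    intro z hz
    have hzE : z ∈ E := by simpa using hstab 1 h1E z hz
    have := hzE v₀' (hv₀'.symm ▸ hv₀) 1 (one_mem_prodSet h1S r)
    rw [hqdef, aevalAt_scale]
    rwa [one_mul, mul_comm] at this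
  obtain ⟨a, haA, ha0, habs⟩ := exists_short_mem_of_vanishes A hq0 hqdeg hqv
  -- Step 6: assembly
  have hfr : Module.finrank ℤ ↥(AddSubgroup.toIntSubmodule A) ≤ d := by
    have := Submodule.finrank_le (AddSubgroup.toIntSubmodule A)
    rwa [Module.finrank_fin_fun] at this
  refine ⟨A, ?_, hsat, ?_, a, haA, ha0, habs⟩
  · intro hbot
    rw [hbot] at haA
    exact ha0 (AddSubgroup.mem_bot.mp haA)
  · have hS : Set.ncard (π '' S) ≤ Set.ncard (π '' E) :=
      Set.ncard_le_ncard (Set.image_mono hSE) hfin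
    calc Set.ncard (π '' S) * D ^ (d - Module.finrank ℤ ↥(AddSubgroup.toIntSubmodule A))
        ≤ D ^ Module.finrank ℤ ↥(AddSubgroup.toIntSubmodule A) *
            D ^ (d - Module.finrank ℤ ↥(AddSubgroup.toIntSubmodule A)) :=
          Nat.mul_le_mul_right _ (hS.trans hcount)
      _ = D ^ d := by rw [← pow_add, Nat.add_sub_cancel' hfr]


end Literature.NumberTheory.Transcendental

end
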